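import Mathlib
import HarnessLib
import Literature.NumberTheory.Irrationality.Zudilin2014.FirstTaleComplex
import Summits.KontsevichZagierPeriods.Zeta5Search.Denom.TwoTaleD1Forms
import Summits.KontsevichZagierPeriods.Zeta5Search.Denom.TwoTaleP15LineRep
import Summits.KontsevichZagierPeriods.Zeta5Search.TwoTaleRungADecay

/-!
# RUNG D1 = L(1/3) `(19,16,13,22 | 0,3,6,38)`: the line representation of `qₙ ζ(2) − pₙ`, and `DecayD1 c` from a line bound

HONEST FRAMING: systematic search; no irrationality claim unless certified.  Cell pub-zeta5 (P1 g12, file T1 of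
fam-denom's `families/denom/D1-DESIGN-NOTE.md`), T3 service.  Nothing here is an irrationality or measure claim: this
file expresses the linear forms of the first-tale cone point `a = (19n+1, 16n+1, 13n+1, 22n+1)`,
`b = (1, 3n+1, 6n+1, 38n+2)` of [Zudilin2014ZetaTwo, §3] (fam-denom's RUNG D1 = L(1/3); `Denom/TwoTaleD1Forms`:
`formQD1`, `formPD1`, input `DecayD1`) as a vertical-line integral, exactly as `TwoTaleRungADecay` does at rung A and
`Denom/TwoTaleP15LineRep` at P15, over the GENERAL Literature objects (`Zudilin2014.RC`, `coefC`, `coefA`, `formQ`,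
`formP`, `RC_shift_eq`):
* `ratRCD1 n s = RC (aD1 n) (bD1 n) s` and the line integral
  `lineIntegralD1 n x = (1/2π) ∫_ℝ (π/sin π(x+iy))² Rₙ(x − a₂* + iy) dy`, `a₂* = 16n+1`;
* `norm_lineIntegralD1_half_le` — on a half-integer line `|π/sin|² = π²/cosh²(πy)`;
* `ratRCD1_polar_newton` — eq. (P1)–(P3) of [Zudilin2014ZetaTwo, §3] at D1 (tree `RC_shift_eq` with
  `a2starD1_eq`), poles indexed by `k ∈ [22n+1, 38n+2) ⊆ ℕ`;
* `lineIntegralD1_half_eq` — term-by-term evaluation on `Re t = ½` by fam-denom's `kernel_integral_expansion`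
  (Lemma 2 + Barnes-type moments, tree);
* **`lineRepD1_holds`**: `qₙ ζ(2) − pₙ = (−1)^d · lineIntegralD1 n ½` for every `n ≥ 1` (`d = dExp = 23n−1`);
* **`decayD1_of_lineBound`**: `DecayD1 c` from a strip shift to the lines `m + ½`, `m ≤ 13n`, and ONE eventual
  half-line bound `(π/2) ∫ |Rₙ(xₙ + ½ − a₂* + iy)|/cosh²(πy) dy ≤ e^{−cn}` (the strip shift is proved in
  `TwoTaleD1StripShift`, the bound in `TwoTaleD1Decay`).
References: W. Zudilin, arXiv:1310.1526 [Zudilin2014ZetaTwo] Prop. 1, Lemmas 1–2, §3.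
-/

noncomputable section

open Complex Set MeasureTheory Filter Topology Finset
open Literature.NumberTheory.Transcendental
open Literature.NumberTheory.Irrationality.Zudilin2014
open Summit.KontsevichZagierPeriods.Zeta5Search.Denom
open Summit.KontsevichZagierPeriods.Zeta5Search.Denom.TwoTaleD1Forms
open Summit.KontsevichZagierPeriods.Zeta5Search.Denom.TwoTaleP15Decay (kernelSq norm_kernelSq_half)
open Summit.KontsevichZagierPeriods.Zeta5Search.Denom.KernelBinomialMoment (barnesP)
open Summit.KontsevichZagierPeriods.Zeta5Search.Denom.KernelPolarMoment (add_natCast_ne_zero)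
open Summit.KontsevichZagierPeriods.Zeta5Search.Denom.TwoTaleP15LineRep
  (kernel_integral_expansion half_line_mem_halfStrip)
open Summit.KontsevichZagierPeriods.Zeta5Search.TwoTaleRungADecay (harmTwo_castC)

namespace Summit.KontsevichZagierPeriods.Zeta5Search.TwoTaleD1LineRep

/-! ### The objects -/

/-- The D1 rational function over `ℂ`: `Rₙ(s) = RC (aD1 n) (bD1 n) s`
(`= Π · ∏(s+i)/∏(s+k)`, [Zudilin2014ZetaTwo, §3, eq. (gc)]). -/
def ratRCD1 (n : ℕ) (s : ℂ) : ℂ := RC (aD1 n) (bD1 n) s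

/-- The vertical-line integral `(1/2π) ∫_ℝ (π/sin π(x+iy))² Rₙ(x − a₂* + iy) dy`, `a₂* = 16n+1` — i.e.
`(1/2πi) ∫_{x−i∞}^{x+i∞} (π/sin πt)² Rₙ(t − a₂*) dt` with `t = x + iy`. -/
def lineIntegralD1 (n : ℕ) (x : ℝ) : ℂ :=
  (1 / (2 * Real.pi) : ℂ) *
    ∫ y : ℝ, kernelSq ((x : ℂ) + (y : ℂ) * I) * ratRCD1 n ((x : ℂ) - (16 * n + 1) + (y : ℂ) * I)

/-- **Norm bound on a half-integer line**: `|lineIntegralD1 n (m+½)| ≤ (π/2) ∫ |Rₙ(m + ½ − a₂* + iy)|/cosh²(πy) dy`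
(from `|π/sin π(m+½+iy)|² = π²/cosh²(πy)` and `‖∫‖ ≤ ∫‖·‖`). -/
theorem norm_lineIntegralD1_half_le (n m : ℕ) :
    ‖lineIntegralD1 n ((m : ℝ) + 1 / 2)‖ ≤ Real.pi / 2 *
      ∫ y : ℝ, ‖ratRCD1 n ((((m : ℝ) + 1 / 2 : ℝ) : ℂ) - (16 * n + 1) + (y : ℂ) * I)‖ /
        Real.cosh (Real.pi * y) ^ 2 := by
  unfold lineIntegralD1
  rw [norm_mul]
  have hnorm : ‖(1 / (2 * Real.pi) : ℂ)‖ = 1 / (2 * Real.pi) := by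
    rw [show (1 / (2 * Real.pi) : ℂ) = ((1 / (2 * Real.pi) : ℝ) : ℂ) by push_cast; ring, Complex.norm_real,
      Real.norm_eq_abs, abs_of_pos (by positivity)]
  rw [hnorm]
  have hint := norm_integral_le_integral_norm (μ := volume)
    (fun y : ℝ => kernelSq ((((m : ℝ) + 1 / 2 : ℝ) : ℂ) + (y : ℂ) * I) *
      ratRCD1 n ((((m : ℝ) + 1 / 2 : ℝ) : ℂ) - (16 * n + 1) + (y : ℂ) * I))
  have heq : (fun y : ℝ => ‖kernelSq ((((m : ℝ) + 1 / 2 : ℝ) : ℂ) + (y : ℂ) * I) *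
      ratRCD1 n ((((m : ℝ) + 1 / 2 : ℝ) : ℂ) - (16 * n + 1) + (y : ℂ) * I)‖) =
      fun y : ℝ => Real.pi ^ 2 * (‖ratRCD1 n ((((m : ℝ) + 1 / 2 : ℝ) : ℂ) - (16 * n + 1) + (y : ℂ) * I)‖ /
        Real.cosh (Real.pi * y) ^ 2) := by
    funext y
    rw [norm_mul, norm_kernelSq_half]
    ring
  rw [heq, integral_const_mul] at hint
  calc 1 / (2 * Real.pi) * ‖∫ y : ℝ, kernelSq ((((m : ℝ) + 1 / 2 : ℝ) : ℂ) + (y : ℂ) * I) *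
          ratRCD1 n ((((m : ℝ) + 1 / 2 : ℝ) : ℂ) - (16 * n + 1) + (y : ℂ) * I)‖
      ≤ 1 / (2 * Real.pi) * (Real.pi ^ 2 *
          ∫ y : ℝ, ‖ratRCD1 n ((((m : ℝ) + 1 / 2 : ℝ) : ℂ) - (16 * n + 1) + (y : ℂ) * I)‖ /
            Real.cosh (Real.pi * y) ^ 2) := by gcongr
    _ = Real.pi / 2 * ∫ y : ℝ, ‖ratRCD1 n ((((m : ℝ) + 1 / 2 : ℝ) : ℂ) - (16 * n + 1) + (y : ℂ) * I)‖ /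
          Real.cosh (Real.pi * y) ^ 2 := by
      rw [← mul_assoc]
      congr 1
      field_simp

/-! ### Partial fractions and Newton expansion at D1 -/

/-- On a line: `s − a₂* + k = s + (k − a₂*)` with `k − a₂* : ℕ` once `k ≥ 22n+1 > a₂* = 16n+1`. -/
theorem line_shift_eqD1 (n k : ℕ) (hk : 22 * n + 1 ≤ k) (s : ℂ) :
    s - (16 * n + 1) + k = s + ((k - (16 * n + 1) : ℕ) : ℂ) := by
  rw [Nat.cast_sub (by omega)]
  push_cast
  ring

/-- On the line `Re t = ½` no shifted pole is met: `(½ + iy) − a₂* + k ≠ 0` for `22n+1 ≤ k`. -/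
theorem line_shift_ne_zeroD1 (n : ℕ) (y : ℝ) :
    ∀ k ∈ Finset.Ico (22 * n + 1) (38 * n + 2), (((1 / 2 : ℝ) : ℂ) + (y : ℂ) * I) - (16 * n + 1) + k ≠ 0 := by
  intro k hk
  rw [line_shift_eqD1 n k (Finset.mem_Ico.1 hk).1]
  exact add_natCast_ne_zero le_rfl (half_line_mem_halfStrip y)

/-- The polar index set of D1 as the image of `[22n+1, 38n+2) ⊆ ℕ`. -/
theorem IcoD1_eq_map (n : ℕ) :
    Finset.Ico (aD1 n 3) (bD1 n 3) = (Finset.Ico (22 * n + 1) (38 * n + 2)).map Nat.castEmbedding := by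
  have e1 : (22 * (n : ℤ) + 1) = ((22 * n + 1 : ℕ) : ℤ) := by push_cast; ring
  have e2 : (38 * (n : ℤ) + 2) = ((38 * n + 2 : ℕ) : ℤ) := by push_cast; ring
  rw [aD1_three, bD1_three, e1, e2, TwoTaleP15Bridge.Ico_natCast_eq_map]

/-- The summation range of `formQ`/`formP` at D1 (`a₄* = amax = 22n+1 = a₄`) as the same image. -/
theorem IcoD1_amax_eq_map (n : ℕ) :
    Finset.Ico (amax (aD1 n)) (bD1 n 3) = (Finset.Ico (22 * n + 1) (38 * n + 2)).map Nat.castEmbedding := by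
  rw [amaxD1_eq, ← IcoD1_eq_map, aD1_three]

/-- `a₂*` at D1, cast to `ℂ`. -/
theorem a2starD1_castC (n : ℕ) : ((a2star (aD1 n) : ℤ) : ℂ) = 16 * n + 1 := by
  rw [a2starD1_eq]; push_cast; ring

/-- **Eq. (P1)–(P3) at D1** ([Zudilin2014ZetaTwo, §3], tree `Zudilin2014.RC_shift_eq`): off the poles,
`Rₙ(t − a₂*) = Σ_{k=22n+1}^{38n+1} C_k/(t − a₂* + k) + Σ_{l ≤ d} A_l · P_l(t)`, `P_l(t) = (t−1)⋯(t−l)/l!`. -/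
theorem ratRCD1_polar_newton {n : ℕ} (hn : 1 ≤ n) (t : ℂ)
    (ht : ∀ k ∈ Finset.Ico (22 * n + 1) (38 * n + 2), t - (16 * n + 1) + k ≠ 0) :
    ratRCD1 n (t - (16 * n + 1)) =
      ∑ k ∈ Finset.Ico (22 * n + 1) (38 * n + 2),
          ((coefC (aD1 n) (bD1 n) (k : ℤ) : ℚ) : ℂ) / (t - (16 * n + 1) + k) +
        ∑ l ∈ Finset.range (dExp (aD1 n) (bD1 n) + 1),
          ((coefA (aD1 n) (bD1 n) l : ℚ) : ℂ) * barnesP l t := by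
  have htZ : ∀ k ∈ Finset.Ico (aD1 n 3) (bD1 n 3), t - (a2star (aD1 n) : ℂ) + (k : ℂ) ≠ 0 := by
    intro k hk
    rw [IcoD1_eq_map, Finset.mem_map] at hk
    obtain ⟨m, hm, rfl⟩ := hk
    rw [a2starD1_castC, Nat.castEmbedding_apply, Int.cast_natCast]
    exact ht m hm
  have h := RC_shift_eq (admissibleD1 hn) t htZ
  rw [a2starD1_castC] at h
  unfold ratRCD1
  rw [h, IcoD1_eq_map, Finset.sum_map]
  congr 1

/-! ### The line representation at D1 -/

/-- **The line integral at `x = ½`, evaluated term by term**: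
`(1/2π) ∫_ℝ (π/sin π(½+iy))² Rₙ(½ − a₂* + iy) dy = Σ_k C_k (ζ(2) − Σ_{i ≤ k−a₂*} i⁻²) + Σ_l A_l (−1)^l/(l+1)`. -/
theorem lineIntegralD1_half_eq {n : ℕ} (hn : 1 ≤ n) :
    lineIntegralD1 n (1 / 2) =
      ∑ k ∈ Ico (22 * n + 1) (38 * n + 2), ((coefC (aD1 n) (bD1 n) (k : ℤ) : ℚ) : ℂ) *
          (((zetaValue 2 - ∑ i ∈ range (k - (16 * n + 1) + 1), (1 : ℝ) / (i : ℝ) ^ 2 : ℝ) : ℂ)) +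
        ∑ l ∈ range (dExp (aD1 n) (bD1 n) + 1),
          ((coefA (aD1 n) (bD1 n) l : ℚ) : ℂ) * ((-1) ^ l / (l + 1)) := by
  have hfun : (fun y : ℝ => kernelSq (((1 / 2 : ℝ) : ℂ) + (y : ℂ) * I) *
        ratRCD1 n (((1 / 2 : ℝ) : ℂ) - (16 * n + 1) + (y : ℂ) * I)) =
      fun y : ℝ => kernelSq (((1 / 2 : ℝ) : ℂ) + (y : ℂ) * I) *
        (∑ k ∈ Ico (22 * n + 1) (38 * n + 2),
            ((coefC (aD1 n) (bD1 n) (k : ℤ) : ℚ) : ℂ) /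
              ((((1 / 2 : ℝ) : ℂ) + (y : ℂ) * I) + ((k - (16 * n + 1) : ℕ) : ℂ)) +
          ∑ l ∈ range (dExp (aD1 n) (bD1 n) + 1),
            ((coefA (aD1 n) (bD1 n) l : ℚ) : ℂ) * barnesP l (((1 / 2 : ℝ) : ℂ) + (y : ℂ) * I)) := by
    funext y
    have harg : ((1 / 2 : ℝ) : ℂ) - (16 * n + 1) + (y : ℂ) * I =
        (((1 / 2 : ℝ) : ℂ) + (y : ℂ) * I) - (16 * n + 1) := by
      ring
    rw [harg, ratRCD1_polar_newton hn _ (line_shift_ne_zeroD1 n y)]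
    congr 2
    refine sum_congr rfl fun k hk => ?_
    rw [line_shift_eqD1 n k (Finset.mem_Ico.1 hk).1]
  unfold lineIntegralD1
  rw [hfun]
  exact kernel_integral_expansion (Ico (22 * n + 1) (38 * n + 2)) (range (dExp (aD1 n) (bD1 n) + 1))
    (fun k => k - (16 * n + 1)) (fun k => ((coefC (aD1 n) (bD1 n) (k : ℤ) : ℚ) : ℂ))
    (fun l => ((coefA (aD1 n) (bD1 n) l : ℚ) : ℂ))

/-- `qₙ` through the Literature's rational form: `(formQD1 n : ℂ) = (−1)^d Σ_{k ∈ [22n+1,38n+2)} C_k`. -/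
theorem formQD1_castC {n : ℕ} (hn : 1 ≤ n) :
    ((formQD1 n : ℤ) : ℂ) = (-1) ^ dExp (aD1 n) (bD1 n) *
      ∑ k ∈ Ico (22 * n + 1) (38 * n + 2), ((coefC (aD1 n) (bD1 n) (k : ℤ) : ℚ) : ℂ) := by
  have h1 : ((formQD1 n : ℤ) : ℂ) = ((formQ (aD1 n) (bD1 n) : ℚ) : ℂ) := by
    rw [← formQD1_cast hn]; push_cast; rfl
  rw [h1, formQ, IcoD1_amax_eq_map, Finset.sum_map]
  push_cast
  rfl

/-- `pₙ` through the Literature's definition: `(formPD1 n : ℂ) = (−1)^d (Σ_k C_k H₂(k − a₂*) − Σ_l (−1)^l A_l/(l+1))`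
with `H₂` expanded as a `range` sum. -/
theorem formPD1_castC (n : ℕ) :
    ((formPD1 n : ℚ) : ℂ) = (-1) ^ dExp (aD1 n) (bD1 n) *
      (∑ k ∈ Ico (22 * n + 1) (38 * n + 2), ((coefC (aD1 n) (bD1 n) (k : ℤ) : ℚ) : ℂ) *
          ∑ i ∈ range (k - (16 * n + 1) + 1), (1 : ℂ) / (i : ℂ) ^ 2 -
        ∑ l ∈ range (dExp (aD1 n) (bD1 n) + 1),
          (-1) ^ l * ((coefA (aD1 n) (bD1 n) l : ℚ) : ℂ) / (l + 1)) := by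
  have hsum : ∑ k ∈ Ico (amax (aD1 n)) (bD1 n 3),
      coefC (aD1 n) (bD1 n) k * harmTwo (k - a2star (aD1 n)).toNat =
      ∑ k ∈ Ico (22 * n + 1) (38 * n + 2),
        coefC (aD1 n) (bD1 n) (k : ℤ) * harmTwo (k - (16 * n + 1)) := by
    rw [IcoD1_amax_eq_map, Finset.sum_map]
    refine Finset.sum_congr rfl fun m hm => ?_
    have hm1 := (Finset.mem_Ico.1 hm).1
    have ht : (((m : ℕ) : ℤ) - a2star (aD1 n)).toNat = m - (16 * n + 1) := by
      rw [a2starD1_eq]; omega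
    rw [Nat.castEmbedding_apply, ht]
  unfold formPD1 formP
  rw [hsum]
  push_cast
  simp only [harmTwo_castC]

/-- **The line representation IS A THEOREM at D1** ([Zudilin2014ZetaTwo, Prop. 1, (P4)–(P5)]: (P1)–(P3) +
linearity + Lemmas 1–2 in kernel form): `qₙ ζ(2) − pₙ = (−1)^d (1/2π) ∫_ℝ (π/sin π(½+iy))² Rₙ(½ − a₂* + iy) dy`
for every `n ≥ 1`. -/
theorem lineRepD1_holds {n : ℕ} (hn : 1 ≤ n) :
    ((formQD1 n : ℤ) : ℂ) * ((zetaValue 2 : ℝ) : ℂ) - ((formPD1 n : ℚ) : ℂ) =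
      (-1) ^ dExp (aD1 n) (bD1 n) * lineIntegralD1 n (1 / 2) := by
  have hU : ∑ l ∈ range (dExp (aD1 n) (bD1 n) + 1),
      ((coefA (aD1 n) (bD1 n) l : ℚ) : ℂ) * ((-1) ^ l / (l + 1)) =
      ∑ l ∈ range (dExp (aD1 n) (bD1 n) + 1),
        (-1) ^ l * ((coefA (aD1 n) (bD1 n) l : ℚ) : ℂ) / (l + 1) :=
    sum_congr rfl fun l _ => by ring
  rw [lineIntegralD1_half_eq hn, hU, formQD1_castC hn, formPD1_castC n]
  push_cast
  simp only [mul_sub, sum_sub_distrib, ← sum_mul]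
  ring

/-! ### `DecayD1 c` from a strip shift and one line bound -/

/-- **`DecayD1 c` from the pieces**: the line representation (proved above), a strip shift to the half-integer
lines `m + ½`, `m ≤ 13n` (hypothesis; proved in `TwoTaleD1StripShift`), and an eventual bound on ONE line
`xₙ + ½`, `xₙ ≤ 13n`. -/
theorem decayD1_of_lineBound {c : ℝ}
    (hShift : ∀ n : ℕ, 1 ≤ n → ∀ m : ℕ, m ≤ 13 * n → lineIntegralD1 n ((m : ℝ) + 1 / 2) = lineIntegralD1 n (1 / 2))
    (x : ℕ → ℕ) (hx : ∀ n, x n ≤ 13 * n)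
    (hB : ∀ᶠ n : ℕ in atTop, Real.pi / 2 *
      ∫ y : ℝ, ‖ratRCD1 n ((((x n : ℝ) + 1 / 2 : ℝ) : ℂ) - (16 * n + 1) + (y : ℂ) * I)‖ /
        Real.cosh (Real.pi * y) ^ 2 ≤ Real.exp (-(c * n))) :
    DecayD1 c := by
  unfold DecayD1
  filter_upwards [hB, eventually_ge_atTop 1] with n hn h1
  have hc : (((formQD1 n : ℝ) * zetaValue 2 - (formPD1 n : ℝ) : ℝ) : ℂ) =
      (-1) ^ dExp (aD1 n) (bD1 n) * lineIntegralD1 n (1 / 2) := by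
    rw [← lineRepD1_holds h1]
    push_cast
    ring
  calc |(formQD1 n : ℝ) * zetaValue 2 - (formPD1 n : ℝ)|
      = ‖(((formQD1 n : ℝ) * zetaValue 2 - (formPD1 n : ℝ) : ℝ) : ℂ)‖ := by
        rw [Complex.norm_real, Real.norm_eq_abs]
    _ = ‖lineIntegralD1 n ((x n : ℝ) + 1 / 2)‖ := by
        rw [hc, norm_mul, norm_pow, norm_neg, norm_one, one_pow, one_mul, hShift n h1 (x n) (hx n)]
    _ ≤ _ := norm_lineIntegralD1_half_le n (x n)
    _ ≤ Real.exp (-(c * n)) := hn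

end Summit.KontsevichZagierPeriods.Zeta5Search.TwoTaleD1LineRep

end
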